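import Summits.Ventures.Crystal3D.Theorems.StickyWulffConstantPolycrystalWulffBoundNearTwinReductionCrux
import Summits.Ventures.Crystal3D.Theorems.StickyWulffConstantPolycrystalWulffBoundNearTwinArithSharp

/-!
# `PolycrystalWulffBound`, lane P: the near-twin reduction at the PAPER RADIUS `2.64°`
# (sharp constant `2 − 2^{2/3}`; helper for crux `stmt-Ventures-19482`; poly-p2 g22; memo C1-COST-g21 §7.1)

Route `StickyWulffConstant` of the venture `Summits/Ventures/Crystal3D`, second prover lane.  The landed
near-twin reduction (`…NearTwinReduction` p753018, `…NearTwinReductionCrux` p753585) uses the arithmetic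
core `nearTwin_arith` with the splitting constant `2/3`, hence the support-gap threshold
`2(2√5 − 1)ε ≤ √3/3` (`ε ≤ 0.0831`, `2.13°`).  This file re-runs the same composition with the SHARP core
`nearTwin_arith_sharp` (`…NearTwinArithSharp`: `(a + b)^{2/3} ≤ a^{2/3} + (2^{2/3} − 1)b^{2/3}`), reaching
the threshold of the paper lemma,

  `2(2√5 − 1)·ε ≤ √3·(2 − 2^{2/3})`,  i.e. `ε ≤ 0.1029`  (every frame within `2.64°` of the twin):

* body level: `twoGrain_nearTwin_of_volume_le_sharp`, `twoGrain_nearTwin_sharp` (the statements of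
  `twoGrain_nearTwin_of_volume_le` / `twoGrain_nearTwin` with the sharp threshold);
* crux frames, `TwoGrainTwinInequality` by name: `nearTwinPair_of_twoGrainTwinInequality_sharp`
  (support-gap form) and `nearTwinFrames_of_twoGrainTwinInequality_sharp` (operator-norm form,
  `2(2√5 − 1)·√5·δ ≤ √3(2 − 2^{2/3})`, `δ ≤ 0.0460`);
* `nearTwin_transport`: the frame bookkeeping of the operator-norm form (`Ax (B A⁻¹ m₀) B B` and the two
  one-sided support gaps with `ε = √5·δ`, from `Ax m₀ A A` and `‖B x − R_{m₀}(A x)‖ ≤ δ‖x‖`).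
Since `√3/3 ≤ √3(2 − 2^{2/3})`, these supersede the `2/3`-constant versions.  WHAT THIS IS NOT: a proof
of the named fact; pairs farther than `2.64°` from the twin are the box certificates' business; the crux
is not claimed; rung F-C1 not moved.
-/

noncomputable section

open scoped BigOperators InnerProductSpace ENNReal Pointwise
open MeasureTheory Filter Set Metric

namespace Summit.Ventures.Crystal3D.Theorems

open Summit.Ventures.Crystal3D.Cruxes.TextureLiminf.TexShadow Literature.Analysis.Convexity
open Literature.MathematicalPhysics.StatisticalMechanics (perimeter HasFinitePerimeter)

/-- **Near-twin reduction, one-sided core, SHARP threshold** (C1-COST-g21 §7.1 with `|S₂| ≤ |S₁|`;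
`twoGrain_nearTwin_of_volume_le` verbatim with `2(2√5 − 1)ε ≤ √3·(2 − 2^{2/3})`, i.e. `ε ≤ 0.1029`).  Disjoint polyhedral
grains `S₁, S₂` of finite volume with `|S₂| ≤ |S₁|`; bodies `W₁ ∋ 0` (compact convex, `⊆ B̄(0,√5)`),
`W₂ ∋ 0` (compact convex symmetric, `B̄(0,√3) ⊆ W₂ ⊆ B̄(0,√5)`), a twin body `W₂' ∋ 0` (compact convex
symmetric) with `h_{W₂'} ≤ h_{W₂} + ε·h_{B̄(0,1)}`, a wall kernel `Dm ⊆ B̄(0,1)` (compact convex `∋ 0`),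
`2(2√5 − 1)ε ≤ √3(2 − 2^{2/3})`, `c ≥ 1`, the Wulff bound for each grain, and the TWIN inequality for
`(W₁, W₂'; ½·Dm)` on `(S₁, S₂)`.  THEN the generic-form inequality for `(W₁, W₂; c·B̄(0,1))` holds on
`(S₁, S₂)`.  Proof: the pair-form facet calculus of `…NearTwinReduction` feeds `nearTwin_arith_sharp` with
`E` = the target energy, `Es` = the twin energy, `J = ι_{B̄}(S₁,S₂)`, `F` = the free area of `S₂`. -/
theorem twoGrain_nearTwin_of_volume_le_sharp {S₁ S₂ : Set E3}
    (hP₁ : ∃ (k : ℕ) (H : Fin k → Finset (E3 × ℝ)), S₁ = ⋃ i, polytope (H i))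
    (hP₂ : ∃ (k : ℕ) (H : Fin k → Finset (E3 × ℝ)), S₂ = ⋃ i, polytope (H i))
    (hv₁ : volume S₁ < ⊤) (hv₂ : volume S₂ < ⊤) (hd : Disjoint S₁ S₂)
    (h21 : volume S₂ ≤ volume S₁)
    {W₁ W₂ W₂' Dm : Set E3}
    (hW₁c : IsCompact W₁) (hW₁v : Convex ℝ W₁) (hW₁0 : (0 : E3) ∈ W₁)
    (hW₂c : IsCompact W₂) (hW₂v : Convex ℝ W₂) (hW₂0 : (0 : E3) ∈ W₂) (hW₂s : -W₂ = W₂)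
    (hW₂'c : IsCompact W₂') (hW₂'v : Convex ℝ W₂') (hW₂'0 : (0 : E3) ∈ W₂') (hW₂'s : -W₂' = W₂')
    (hDmc : IsCompact Dm) (hDmv : Convex ℝ Dm) (hDm0 : (0 : E3) ∈ Dm)
    (hW₁R : W₁ ⊆ closedBall (0 : E3) (Real.sqrt 5)) (hW₂R : W₂ ⊆ closedBall (0 : E3) (Real.sqrt 5))
    (hW₂r : closedBall (0 : E3) (Real.sqrt 3) ⊆ W₂) (hDm1 : Dm ⊆ closedBall (0 : E3) 1)
    {ε c : ℝ} (hε : 2 * (2 * Real.sqrt 5 - 1) * ε ≤ Real.sqrt 3 * (2 - (2 : ℝ) ^ ((2 : ℝ) / 3))) (hc : 1 ≤ c)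
    (hgap : ∀ ν : E3, supportFn W₂' ν ≤ supportFn W₂ ν + ε * supportFn (closedBall (0 : E3) 1) ν)
    (hWulff₁ : 6 * (2 : ℝ) ^ ((1 : ℝ) / 3) * (Real.sqrt 2 * (volume S₁).toReal) ^ ((2 : ℝ) / 3) ≤
      per W₁ S₁)
    (hWulff₂ : 6 * (2 : ℝ) ^ ((1 : ℝ) / 3) * (Real.sqrt 2 * (volume S₂).toReal) ^ ((2 : ℝ) / 3) ≤
      per W₂ S₂)
    (htwin : 6 * (2 : ℝ) ^ ((1 : ℝ) / 3) * (Real.sqrt 2 * (volume (S₁ ∪ S₂)).toReal) ^ ((2 : ℝ) / 3) ≤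
      (per W₁ S₁ - (per W₁ S₁ + per W₁ S₂ - per W₁ (S₁ ∪ S₂)) / 2) +
      (per W₂' S₂ - (per W₂' S₂ + per W₂' S₁ - per W₂' (S₂ ∪ S₁)) / 2) +
      1 / 2 * ((per Dm S₁ + per Dm S₂ - per Dm (S₁ ∪ S₂)) / 2)) :
    6 * (2 : ℝ) ^ ((1 : ℝ) / 3) * (Real.sqrt 2 * (volume (S₁ ∪ S₂)).toReal) ^ ((2 : ℝ) / 3) ≤
      (per W₁ S₁ - (per W₁ S₁ + per W₁ S₂ - per W₁ (S₁ ∪ S₂)) / 2) +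
      (per W₂ S₂ - (per W₂ S₂ + per W₂ S₁ - per W₂ (S₂ ∪ S₁)) / 2) +
      c * ((per (closedBall (0 : E3) 1) S₁ + per (closedBall (0 : E3) 1) S₂ -
        per (closedBall (0 : E3) 1) (S₁ ∪ S₂)) / 2) := by
  have h3pos : 0 < Real.sqrt 3 := Real.sqrt_pos.2 (by norm_num)
  have h5pos : 0 < Real.sqrt 5 := Real.sqrt_pos.2 (by norm_num)
  have hB : IsCompact (closedBall (0 : E3) 1) := isCompact_closedBall 0 1
  have hBv : Convex ℝ (closedBall (0 : E3) 1) := convex_closedBall 0 1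
  have hB0 : (0 : E3) ∈ closedBall (0 : E3) 1 := mem_closedBall_self zero_le_one
  have hBs : -closedBall (0 : E3) 1 = closedBall (0 : E3) 1 := by simp
  have hB5 : IsCompact (closedBall (0 : E3) (Real.sqrt 5)) := isCompact_closedBall 0 _
  have hB5v : Convex ℝ (closedBall (0 : E3) (Real.sqrt 5)) := convex_closedBall 0 _
  have hB50 : (0 : E3) ∈ closedBall (0 : E3) (Real.sqrt 5) := mem_closedBall_self h5pos.le
  have hvol : (volume (S₁ ∪ S₂)).toReal = (volume S₁).toReal + (volume S₂).toReal :=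
    toReal_volume_union_pair hP₂ hv₁ hv₂ hd
  set V₁ : ℝ := (volume S₁).toReal with hV₁
  set V₂ : ℝ := (volume S₂).toReal with hV₂
  have hV₂0 : 0 ≤ V₂ := ENNReal.toReal_nonneg
  have hV21 : V₂ ≤ V₁ := ENNReal.toReal_mono hv₁.ne h21
  set J : ℝ := (per (closedBall (0 : E3) 1) S₁ + per (closedBall (0 : E3) 1) S₂ -
    per (closedBall (0 : E3) 1) (S₁ ∪ S₂)) / 2 with hJ
  set F : ℝ := per (closedBall (0 : E3) 1) S₂ - (per (closedBall (0 : E3) 1) S₂ +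
    per (closedBall (0 : E3) 1) S₁ - per (closedBall (0 : E3) 1) (S₂ ∪ S₁)) / 2 with hF
  -- (1) the wall term of the unit ball is nonnegative
  have hJ0 : 0 ≤ J := by
    have h := pair_iota_nonneg hP₁ hP₂ hv₁ hv₂ hd hB hBv hB0
    rw [hJ]; linarith
  -- (2) the Wulff-body wall terms are at most `√5·J`, the kernel's at most `J`
  have hι₁ : (per W₁ S₁ + per W₁ S₂ - per W₁ (S₁ ∪ S₂)) / 2 ≤ Real.sqrt 5 * J := by
    have h := pair_iota_mono hP₁ hP₂ hv₁ hv₂ hd hW₁c hW₁v hW₁0 hB5 hB5v hB50 hW₁R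
    rw [pair_iota_closedBall S₁ S₂ h5pos] at h
    rw [hJ]; linarith
  have hι₂ : (per W₂ S₂ + per W₂ S₁ - per W₂ (S₂ ∪ S₁)) / 2 ≤ Real.sqrt 5 * J := by
    have h := pair_iota_mono hP₁ hP₂ hv₁ hv₂ hd hW₂c hW₂v hW₂0 hB5 hB5v hB50 hW₂R
    rw [pair_iota_closedBall S₁ S₂ h5pos] at h
    rw [hJ, union_comm S₂ S₁]; linarith
  have hιm : (per Dm S₁ + per Dm S₂ - per Dm (S₁ ∪ S₂)) / 2 ≤ J := by
    have h := pair_iota_mono hP₁ hP₂ hv₁ hv₂ hd hDmc hDmv hDm0 hB hBv hB0 hDm1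
    rw [hJ]; linarith
  -- (3) the body change on grain 2 costs at most `ε·F`
  have hgap' : per W₂' S₂ - (per W₂' S₂ + per W₂' S₁ - per W₂' (S₂ ∪ S₁)) / 2 ≤
      (per W₂ S₂ - (per W₂ S₂ + per W₂ S₁ - per W₂ (S₂ ∪ S₁)) / 2) + ε * F :=
    pair_freeEnergy_le_add_of_gap hP₁ hP₂ hv₁ hv₂ hd hW₂c hW₂v hW₂0 hW₂s hW₂'c hW₂'v hW₂'0 hW₂'s
      hB hBv hB0 hBs hgap
  -- (4) the free area of grain 2: `0 ≤ F ≤ Per(S₂)` and `√3·Per(S₂) ≤ per W₂ S₂`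
  have hF0 : 0 ≤ F := pair_freeArea_nonneg hP₁ hP₂ hv₁ hv₂ hd
  have hFle : F ≤ per (closedBall (0 : E3) 1) S₂ := by
    have h := pair_iota_nonneg hP₁ hP₂ hv₁ hv₂ hd hB hBv hB0
    rw [hF, union_comm S₂ S₁]; linarith
  have hP₂ge : Real.sqrt 3 * per (closedBall (0 : E3) 1) S₂ ≤ per W₂ S₂ := by
    have h := per_mono_of_subset hW₂r h5pos hW₂R (hasFinitePerimeter_of_poly hP₂ hv₂)
    rw [per_closedBall_eq_mul_perimeter h3pos] at h
    rwa [per_closedBall_eq_mul_perimeter one_pos, one_mul]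
  have h6 : Real.sqrt 3 * F ≤ per W₂ S₂ :=
    (mul_le_mul_of_nonneg_left hFle h3pos.le).trans hP₂ge
  -- (5) assemble with the arithmetic core
  rw [hvol, mul_add] at htwin ⊢
  have hcJ : J ≤ c * J := le_mul_of_one_le_left hJ0 hc
  exact nearTwin_arith_sharp (J := J) (by positivity) (mul_nonneg (Real.sqrt_nonneg 2) hV₂0)
    (mul_le_mul_of_nonneg_left hV21 (Real.sqrt_nonneg 2)) hε hF0
    (by linarith) htwin (by linarith) hWulff₁ hWulff₂ h6

/-- **Near-twin reduction at the level of bodies, SHARP threshold** (no volume ordering).  As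
`twoGrain_nearTwin_of_volume_le_sharp`, with BOTH Wulff bodies symmetric with `B̄(0,√3) ⊆ W_i ⊆ B̄(0,√5)` and a
twin body on EITHER side: `W₂'` (gap to `W₂`, kernel `Dm`, twin inequality for `(W₁, W₂'; ½Dm)` on
`(S₁, S₂)`) and `W₁'` (gap to `W₁`, kernel `Dm'`, twin inequality for `(W₂, W₁'; ½Dm')` on `(S₂, S₁)` —
the shape lane P's named fact produces for the frame of grain 2).  Whichever grain is the smaller has
its law swapped. -/
theorem twoGrain_nearTwin_sharp {S₁ S₂ : Set E3}
    (hP₁ : ∃ (k : ℕ) (H : Fin k → Finset (E3 × ℝ)), S₁ = ⋃ i, polytope (H i))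
    (hP₂ : ∃ (k : ℕ) (H : Fin k → Finset (E3 × ℝ)), S₂ = ⋃ i, polytope (H i))
    (hv₁ : volume S₁ < ⊤) (hv₂ : volume S₂ < ⊤) (hd : Disjoint S₁ S₂)
    {W₁ W₂ W₁' W₂' Dm Dm' : Set E3}
    (hW₁c : IsCompact W₁) (hW₁v : Convex ℝ W₁) (hW₁0 : (0 : E3) ∈ W₁) (hW₁s : -W₁ = W₁)
    (hW₂c : IsCompact W₂) (hW₂v : Convex ℝ W₂) (hW₂0 : (0 : E3) ∈ W₂) (hW₂s : -W₂ = W₂)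
    (hW₁'c : IsCompact W₁') (hW₁'v : Convex ℝ W₁') (hW₁'0 : (0 : E3) ∈ W₁') (hW₁'s : -W₁' = W₁')
    (hW₂'c : IsCompact W₂') (hW₂'v : Convex ℝ W₂') (hW₂'0 : (0 : E3) ∈ W₂') (hW₂'s : -W₂' = W₂')
    (hDmc : IsCompact Dm) (hDmv : Convex ℝ Dm) (hDm0 : (0 : E3) ∈ Dm)
    (hDm'c : IsCompact Dm') (hDm'v : Convex ℝ Dm') (hDm'0 : (0 : E3) ∈ Dm')
    (hW₁R : W₁ ⊆ closedBall (0 : E3) (Real.sqrt 5)) (hW₂R : W₂ ⊆ closedBall (0 : E3) (Real.sqrt 5))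
    (hW₁r : closedBall (0 : E3) (Real.sqrt 3) ⊆ W₁) (hW₂r : closedBall (0 : E3) (Real.sqrt 3) ⊆ W₂)
    (hDm1 : Dm ⊆ closedBall (0 : E3) 1) (hDm'1 : Dm' ⊆ closedBall (0 : E3) 1)
    {ε c : ℝ} (hε : 2 * (2 * Real.sqrt 5 - 1) * ε ≤ Real.sqrt 3 * (2 - (2 : ℝ) ^ ((2 : ℝ) / 3))) (hc : 1 ≤ c)
    (hgap₂ : ∀ ν : E3, supportFn W₂' ν ≤ supportFn W₂ ν + ε * supportFn (closedBall (0 : E3) 1) ν)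
    (hgap₁ : ∀ ν : E3, supportFn W₁' ν ≤ supportFn W₁ ν + ε * supportFn (closedBall (0 : E3) 1) ν)
    (hWulff₁ : 6 * (2 : ℝ) ^ ((1 : ℝ) / 3) * (Real.sqrt 2 * (volume S₁).toReal) ^ ((2 : ℝ) / 3) ≤
      per W₁ S₁)
    (hWulff₂ : 6 * (2 : ℝ) ^ ((1 : ℝ) / 3) * (Real.sqrt 2 * (volume S₂).toReal) ^ ((2 : ℝ) / 3) ≤
      per W₂ S₂)
    (htwin₂ : 6 * (2 : ℝ) ^ ((1 : ℝ) / 3) * (Real.sqrt 2 * (volume (S₁ ∪ S₂)).toReal) ^ ((2 : ℝ) / 3) ≤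
      (per W₁ S₁ - (per W₁ S₁ + per W₁ S₂ - per W₁ (S₁ ∪ S₂)) / 2) +
      (per W₂' S₂ - (per W₂' S₂ + per W₂' S₁ - per W₂' (S₂ ∪ S₁)) / 2) +
      1 / 2 * ((per Dm S₁ + per Dm S₂ - per Dm (S₁ ∪ S₂)) / 2))
    (htwin₁ : 6 * (2 : ℝ) ^ ((1 : ℝ) / 3) * (Real.sqrt 2 * (volume (S₂ ∪ S₁)).toReal) ^ ((2 : ℝ) / 3) ≤
      (per W₂ S₂ - (per W₂ S₂ + per W₂ S₁ - per W₂ (S₂ ∪ S₁)) / 2) +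
      (per W₁' S₁ - (per W₁' S₁ + per W₁' S₂ - per W₁' (S₁ ∪ S₂)) / 2) +
      1 / 2 * ((per Dm' S₂ + per Dm' S₁ - per Dm' (S₂ ∪ S₁)) / 2)) :
    6 * (2 : ℝ) ^ ((1 : ℝ) / 3) * (Real.sqrt 2 * (volume (S₁ ∪ S₂)).toReal) ^ ((2 : ℝ) / 3) ≤
      (per W₁ S₁ - (per W₁ S₁ + per W₁ S₂ - per W₁ (S₁ ∪ S₂)) / 2) +
      (per W₂ S₂ - (per W₂ S₂ + per W₂ S₁ - per W₂ (S₂ ∪ S₁)) / 2) +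
      c * ((per (closedBall (0 : E3) 1) S₁ + per (closedBall (0 : E3) 1) S₂ -
        per (closedBall (0 : E3) 1) (S₁ ∪ S₂)) / 2) := by
  rcases le_total (volume S₂) (volume S₁) with h21 | h12
  · -- grain 2 is the smaller one: swap its law
    exact twoGrain_nearTwin_of_volume_le_sharp hP₁ hP₂ hv₁ hv₂ hd h21 hW₁c hW₁v hW₁0 hW₂c hW₂v hW₂0 hW₂s
      hW₂'c hW₂'v hW₂'0 hW₂'s hDmc hDmv hDm0 hW₁R hW₂R hW₂r hDm1 hε hc hgap₂ hWulff₁ hWulff₂ htwin₂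
  · -- grain 1 is the smaller one: the core with the two grains exchanged
    have h := twoGrain_nearTwin_of_volume_le_sharp hP₂ hP₁ hv₂ hv₁ hd.symm h12 hW₂c hW₂v hW₂0 hW₁c hW₁v
      hW₁0 hW₁s hW₁'c hW₁'v hW₁'0 hW₁'s hDm'c hDm'v hDm'0 hW₂R hW₁R hW₁r hDm'1 hε hc hgap₁ hWulff₂
      hWulff₁ htwin₁
    rw [union_comm S₂ S₁] at h ⊢
    linarith

end Summit.Ventures.Crystal3D.Theorems

namespace Summit.Ventures.Crystal3D.Cruxes.PolycrystalWulffBound.PolyDensity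

open Summit.Ventures.Crystal3D.Theorems
open Summit.Ventures.Crystal3D.Cruxes.TextureLiminf.TexShadow (per polytope supportFn E3)
open Literature.MathematicalPhysics.StatisticalMechanics (fccStacking barlowStacking IsHaggSeq)
open Literature.Analysis.Convexity

/-- **Frame bookkeeping of the operator-norm form.**  If `m₀` is a stacking axis of the crux frame `A`
(`Ax m₀ A A`, spelled out) and `‖B x − R_{m₀}(A x)‖ ≤ δ‖x‖` for all `x`, then `B A⁻¹ m₀` is a stacking
axis of `B` (transport along the isometry `B A⁻¹`) and the two one-sided support gaps of the near-twin
reduction hold with `ε = √5·δ`: `h_{R_{m₀} W(A)} ≤ h_{W(B)} + √5δ‖·‖` and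
`h_{R_{B A⁻¹ m₀} W(B)} ≤ h_{W(A)} + √5δ‖·‖` (`W(X) = X '' W(1) ⊆ B̄(0,√5)`, `supportFn_image_le_of_norm_sub_le`,
`reflection_perp_conj`). -/
theorem nearTwin_transport {A B : EuclideanSpace ℝ (Fin 3) ≃ₗᵢ[ℝ] EuclideanSpace ℝ (Fin 3)}
    {m₀ : EuclideanSpace ℝ (Fin 3)} {δ : ℝ}
    (hA : ∃ (L : EuclideanSpace ℝ (Fin 3) ≃ₗᵢ[ℝ] EuclideanSpace ℝ (Fin 3)) (s₁ s₂ : EuclideanSpace ℝ (Fin 3))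
      (σ σ' : ℤ → ℤ), IsHaggSeq σ ∧ IsHaggSeq σ' ∧ L (EuclideanSpace.single (2 : Fin 3) (1 : ℝ)) = m₀ ∧
      A '' fccStacking 1 (Real.sqrt (2 / 3)) ⊆
        (fun q => L q + s₁) '' barlowStacking 1 (Real.sqrt (2 / 3)) σ ∧
      A '' fccStacking 1 (Real.sqrt (2 / 3)) ⊆
        (fun q => L q + s₂) '' barlowStacking 1 (Real.sqrt (2 / 3)) σ')
    (hnear : ∀ x : EuclideanSpace ℝ (Fin 3), ‖B x - (ℝ ∙ m₀)ᗮ.reflection (A x)‖ ≤ δ * ‖x‖) :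
    (∃ (L : EuclideanSpace ℝ (Fin 3) ≃ₗᵢ[ℝ] EuclideanSpace ℝ (Fin 3)) (s₁ s₂ : EuclideanSpace ℝ (Fin 3))
      (σ σ' : ℤ → ℤ), IsHaggSeq σ ∧ IsHaggSeq σ' ∧
      L (EuclideanSpace.single (2 : Fin 3) (1 : ℝ)) = B (A.symm m₀) ∧
      B '' fccStacking 1 (Real.sqrt (2 / 3)) ⊆
        (fun q => L q + s₁) '' barlowStacking 1 (Real.sqrt (2 / 3)) σ ∧
      B '' fccStacking 1 (Real.sqrt (2 / 3)) ⊆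
        (fun q => L q + s₂) '' barlowStacking 1 (Real.sqrt (2 / 3)) σ') ∧
    (∀ ν : EuclideanSpace ℝ (Fin 3),
      supportFn ((ℝ ∙ m₀)ᗮ.reflection '' {y : EuclideanSpace ℝ (Fin 3) | ∀ ν : EuclideanSpace ℝ (Fin 3), ⟪y, ν⟫_ℝ ≤ Real.sqrt 2 / 4 *
        ∑ᶠ w ∈ {w | w ∈ fccStacking 1 (Real.sqrt (2 / 3)) ∧ ‖w‖ = 1}, |⟪w, A.symm ν⟫_ℝ|}) ν ≤ supportFn {y : EuclideanSpace ℝ (Fin 3) | ∀ ν : EuclideanSpace ℝ (Fin 3), ⟪y, ν⟫_ℝ ≤ Real.sqrt 2 / 4 *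
        ∑ᶠ w ∈ {w | w ∈ fccStacking 1 (Real.sqrt (2 / 3)) ∧ ‖w‖ = 1}, |⟪w, B.symm ν⟫_ℝ|} ν + Real.sqrt 5 * δ * ‖ν‖) ∧
    (∀ ν : EuclideanSpace ℝ (Fin 3),
      supportFn ((ℝ ∙ B (A.symm m₀))ᗮ.reflection '' {y : EuclideanSpace ℝ (Fin 3) | ∀ ν : EuclideanSpace ℝ (Fin 3), ⟪y, ν⟫_ℝ ≤ Real.sqrt 2 / 4 *
        ∑ᶠ w ∈ {w | w ∈ fccStacking 1 (Real.sqrt (2 / 3)) ∧ ‖w‖ = 1}, |⟪w, B.symm ν⟫_ℝ|}) ν ≤ supportFn {y : EuclideanSpace ℝ (Fin 3) | ∀ ν : EuclideanSpace ℝ (Fin 3), ⟪y, ν⟫_ℝ ≤ Real.sqrt 2 / 4 *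
        ∑ᶠ w ∈ {w | w ∈ fccStacking 1 (Real.sqrt (2 / 3)) ∧ ‖w‖ = 1}, |⟪w, A.symm ν⟫_ℝ|} ν + Real.sqrt 5 * δ * ‖ν‖) := by
  obtain ⟨L, s₁, s₂, σ, σ', hσ, hσ', hLm, hAΛ, hAΛ'⟩ := hA
  have hm₀ : ‖m₀‖ = 1 := by
    rw [← hLm, LinearIsometryEquiv.norm_map, PiLp.norm_single, norm_one]
  obtain ⟨Q, hQ⟩ : ∃ Q : E3 ≃ₗᵢ[ℝ] E3, ∀ x, Q x = B (A.symm x) := ⟨A.symm.trans B, fun _ => rfl⟩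
  have hQm : Q m₀ = B (A.symm m₀) := hQ m₀
  -- the reference body `W(1)` and `W X = X '' W(1)`
  set W₁ : Set E3 := {y : EuclideanSpace ℝ (Fin 3) | ∀ ν : EuclideanSpace ℝ (Fin 3), ⟪y, ν⟫_ℝ ≤ Real.sqrt 2 / 4 *
        ∑ᶠ w ∈ {w | w ∈ fccStacking 1 (Real.sqrt (2 / 3)) ∧ ‖w‖ = 1},
          |⟪w, (LinearIsometryEquiv.refl ℝ (EuclideanSpace ℝ (Fin 3))).symm ν⟫_ℝ|} with hW₁
  have hWA : {y : EuclideanSpace ℝ (Fin 3) | ∀ ν : EuclideanSpace ℝ (Fin 3), ⟪y, ν⟫_ℝ ≤ Real.sqrt 2 / 4 *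
        ∑ᶠ w ∈ {w | w ∈ fccStacking 1 (Real.sqrt (2 / 3)) ∧ ‖w‖ = 1}, |⟪w, A.symm ν⟫_ℝ|} = A '' W₁ := cruxWulffBody_eq_image_self A
  have hWB : {y : EuclideanSpace ℝ (Fin 3) | ∀ ν : EuclideanSpace ℝ (Fin 3), ⟪y, ν⟫_ℝ ≤ Real.sqrt 2 / 4 *
        ∑ᶠ w ∈ {w | w ∈ fccStacking 1 (Real.sqrt (2 / 3)) ∧ ‖w‖ = 1}, |⟪w, B.symm ν⟫_ℝ|} = B '' W₁ := cruxWulffBody_eq_image_self B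
  have hW₁R : W₁ ⊆ closedBall (0 : E3) (Real.sqrt 5) := cruxWulffBody_subset_closedBall _
  have hW₁ne : W₁.Nonempty := ⟨0, zero_mem_cruxWulffBody _⟩
  refine ⟨⟨L.trans Q, Q s₁, Q s₂, σ, σ', hσ, hσ', ?_, ?_, ?_⟩, ?_, ?_⟩
  · show Q (L (EuclideanSpace.single (2 : Fin 3) (1 : ℝ))) = B (A.symm m₀)
    rw [hLm, hQm]
  · rintro _ ⟨p, hp, rfl⟩
    obtain ⟨q, hq, hqe⟩ := hAΛ ⟨p, hp, rfl⟩
    refine ⟨q, hq, ?_⟩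
    show Q (L q) + Q s₁ = B p
    rw [← map_add, show L q + s₁ = A p from hqe, hQ, A.symm_apply_apply]
  · rintro _ ⟨p, hp, rfl⟩
    obtain ⟨q, hq, hqe⟩ := hAΛ' ⟨p, hp, rfl⟩
    refine ⟨q, hq, ?_⟩
    show Q (L q) + Q s₂ = B p
    rw [← map_add, show L q + s₂ = A p from hqe, hQ, A.symm_apply_apply]
  · -- gap 1: the twin of `A` about `m₀` against `B`
    intro ν
    rw [hWA, hWB, ← Set.image_comp, ← LinearIsometryEquiv.coe_trans]
    refine supportFn_image_le_of_norm_sub_le hW₁R hW₁ne (Real.sqrt_nonneg 5) _ _ (fun μ => ?_) ν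
    rw [LinearIsometryEquiv.symm_trans, LinearIsometryEquiv.trans_apply, Submodule.reflection_symm]
    set x : E3 := A.symm ((ℝ ∙ m₀)ᗮ.reflection μ) with hx
    have hxμ : (ℝ ∙ m₀)ᗮ.reflection (A x) = μ := by
      rw [hx, A.apply_symm_apply, Submodule.reflection_reflection]
    have hnx : ‖x‖ = ‖μ‖ := by
      rw [hx, A.symm.norm_map, LinearIsometryEquiv.norm_map]
    have hdiff : x - B.symm μ = B.symm (B x - (ℝ ∙ m₀)ᗮ.reflection (A x)) := by
      rw [map_sub, B.symm_apply_apply, hxμ]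
    rw [hdiff, B.symm.norm_map, ← hnx]
    exact hnear x
  · -- gap 2: the twin of `B` about `B A⁻¹ m₀` against `A`
    intro ν
    rw [hWA, hWB, ← Set.image_comp, ← LinearIsometryEquiv.coe_trans, ← hQm]
    refine supportFn_image_le_of_norm_sub_le hW₁R hW₁ne (Real.sqrt_nonneg 5) _ _ (fun μ => ?_) ν
    rw [LinearIsometryEquiv.symm_trans, LinearIsometryEquiv.trans_apply, Submodule.reflection_symm]
    set x : E3 := B.symm μ with hx
    have hμ : μ = Q (A x) := by rw [hQ, A.symm_apply_apply, hx, B.apply_symm_apply]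
    have hrefl : (ℝ ∙ Q m₀)ᗮ.reflection μ = Q ((ℝ ∙ m₀)ᗮ.reflection (A x)) := by
      rw [hμ, reflection_perp_conj Q hm₀ (A x)]
    have hdiff : B.symm ((ℝ ∙ Q m₀)ᗮ.reflection μ) - A.symm μ =
        A.symm ((ℝ ∙ m₀)ᗮ.reflection (A x) - B x) := by
      rw [hrefl, hQ, B.symm_apply_apply, map_sub, hx, B.apply_symm_apply]
    have hnx : ‖x‖ = ‖μ‖ := by rw [hx, B.symm.norm_map]
    rw [hdiff, A.symm.norm_map, norm_sub_rev, ← hnx]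
    exact hnear x

/-- **Near-twin reduction, support-gap form, SHARP threshold** (`TwoGrainTwinInequality` by name):
`nearTwinPair_of_twoGrainTwinInequality` verbatim with `2(2√5 − 1)ε ≤ √3(2 − 2^{2/3})` (`ε ≤ 0.1029`,
`2.64°`).  Proof: `twoGrain_nearTwin_sharp`. -/
theorem nearTwinPair_of_twoGrainTwinInequality_sharp (hTG : TwoGrainTwinInequality) {c ε : ℝ}
    (hc : 1 ≤ c) (hε : 2 * (2 * Real.sqrt 5 - 1) * ε ≤ Real.sqrt 3 * (2 - (2 : ℝ) ^ ((2 : ℝ) / 3))) :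
    let Λ : Set (EuclideanSpace ℝ (Fin 3)) := Literature.MathematicalPhysics.StatisticalMechanics.fccStacking 1 (Real.sqrt (2 / 3));
    let Brl : (ℤ → ℤ) → Set (EuclideanSpace ℝ (Fin 3)) := Literature.MathematicalPhysics.StatisticalMechanics.barlowStacking 1 (Real.sqrt (2 / 3));
    let Ax : EuclideanSpace ℝ (Fin 3) → (EuclideanSpace ℝ (Fin 3) ≃ₗᵢ[ℝ] EuclideanSpace ℝ (Fin 3)) → (EuclideanSpace ℝ (Fin 3) ≃ₗᵢ[ℝ] EuclideanSpace ℝ (Fin 3)) → Prop := fun m A B => ∃ (L : EuclideanSpace ℝ (Fin 3) ≃ₗᵢ[ℝ] EuclideanSpace ℝ (Fin 3)) (s₁ s₂ : EuclideanSpace ℝ (Fin 3)) (σ σ' : ℤ → ℤ), Literature.MathematicalPhysics.StatisticalMechanics.IsHaggSeq σ ∧ Literature.MathematicalPhysics.StatisticalMechanics.IsHaggSeq σ' ∧ L (EuclideanSpace.single (2 : Fin 3) (1 : ℝ)) = m ∧ A '' Λ ⊆ (fun q => L q + s₁) '' Brl σ ∧ B '' Λ ⊆ (fun q => L q + s₂)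 '' Brl σ';
    let Φ : EuclideanSpace ℝ (Fin 3) → ℝ := fun ν => Real.sqrt 2 / 4 * ∑ᶠ w ∈ {w ∈ Λ | ‖w‖ = 1}, |⟪w, ν⟫_ℝ|;
    let Per : Set (EuclideanSpace ℝ (Fin 3)) → Set (EuclideanSpace ℝ (Fin 3)) → ℝ := fun K S => (⨆ (ξ : EuclideanSpace ℝ (Fin 3) → EuclideanSpace ℝ (Fin 3)) (_ : ContDiff ℝ 1 ξ ∧ HasCompactSupport ξ ∧ ∀ z, ξ z ∈ K), ENNReal.ofReal (∫ z in S, Literature.MathematicalPhysics.StatisticalMechanics.fieldDivergence ξ z)).toReal;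
    let ι : Set (EuclideanSpace ℝ (Fin 3)) → Set (EuclideanSpace ℝ (Fin 3)) → Set (EuclideanSpace ℝ (Fin 3)) → ℝ := fun K S₁ S₂ => (Per K S₁ + Per K S₂ - Per K (S₁ ∪ S₂)) / 2;
    let W : (EuclideanSpace ℝ (Fin 3) ≃ₗᵢ[ℝ] EuclideanSpace ℝ (Fin 3)) → Set (EuclideanSpace ℝ (Fin 3)) := fun A => {y | ∀ ν : EuclideanSpace ℝ (Fin 3), ⟪y, ν⟫_ℝ ≤ Φ (A.symm ν)};
    let Dsc : EuclideanSpace ℝ (Fin 3) → Set (EuclideanSpace ℝ (Fin 3)) := fun m => {y | ‖y‖ ≤ 1 ∧ ⟪y, m⟫_ℝ = 0};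
    let Poly : Set (EuclideanSpace ℝ (Fin 3)) → Prop := fun S => ∃ (k : ℕ) (H : Fin k → Finset ((EuclideanSpace ℝ (Fin 3)) × ℝ)), S = ⋃ i, ⋂ p ∈ H i, {x | ⟪p.1, x⟫_ℝ < p.2};
    ∀ (A B : EuclideanSpace ℝ (Fin 3) ≃ₗᵢ[ℝ] EuclideanSpace ℝ (Fin 3)) (m₀ m₁ : EuclideanSpace ℝ (Fin 3)),
      Ax m₀ A A → Ax m₁ B B →
      (∀ ν : EuclideanSpace ℝ (Fin 3),
        supportFn ((ℝ ∙ m₀)ᗮ.reflection '' W A) ν ≤ supportFn (W B) ν + ε * ‖ν‖) →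
      (∀ ν : EuclideanSpace ℝ (Fin 3),
        supportFn ((ℝ ∙ m₁)ᗮ.reflection '' W B) ν ≤ supportFn (W A) ν + ε * ‖ν‖) →
      ∀ S₁ S₂ : Set (EuclideanSpace ℝ (Fin 3)), Poly S₁ → Poly S₂ → volume S₁ < ⊤ → volume S₂ < ⊤ → Disjoint S₁ S₂ →
        6 * (2 : ℝ) ^ ((1 : ℝ) / 3) * (Real.sqrt 2 * (volume (S₁ ∪ S₂)).toReal) ^ ((2 : ℝ) / 3) ≤
          (Per (W A) S₁ - ι (W A) S₁ S₂) + (Per (W B) S₂ - ι (W B) S₂ S₁) + c * ι (Dsc 0) S₁ S₂ := by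
  intro Λ Brl Ax Φ Per ι W Dsc Poly A B m₀ m₁ hA hB hgap₂ hgap₁ S₁ S₂ hP₁ hP₂ hv₁ hv₂ hd
  -- the Wulff bodies and their mirror images
  have hWc : ∀ X : E3 ≃ₗᵢ[ℝ] E3, IsCompact (W X) := fun X => isCompact_cruxWulffBody X
  have hWv : ∀ X : E3 ≃ₗᵢ[ℝ] E3, Convex ℝ (W X) := fun X => convex_cruxWulffBody X
  have hW0 : ∀ X : E3 ≃ₗᵢ[ℝ] E3, (0 : E3) ∈ W X := fun X => zero_mem_cruxWulffBody X
  have hWs : ∀ X : E3 ≃ₗᵢ[ℝ] E3, -W X = W X := fun X => neg_cruxWulffBody_eq X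
  have hWR : ∀ X : E3 ≃ₗᵢ[ℝ] E3, W X ⊆ closedBall (0 : E3) (Real.sqrt 5) := fun X =>
    cruxWulffBody_subset_closedBall X
  have hWr : ∀ X : E3 ≃ₗᵢ[ℝ] E3, closedBall (0 : E3) (Real.sqrt 3) ⊆ W X := fun X =>
    closedBall_subset_cruxWulffBody X
  have himc : ∀ R X : E3 ≃ₗᵢ[ℝ] E3, IsCompact (R '' W X) := fun R X => (hWc X).image R.continuous
  have himv : ∀ R X : E3 ≃ₗᵢ[ℝ] E3, Convex ℝ (R '' W X) := fun R X =>
    (hWv X).linear_image R.toLinearEquiv.toLinearMap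
  have him0 : ∀ R X : E3 ≃ₗᵢ[ℝ] E3, (0 : E3) ∈ R '' W X := fun R X => ⟨0, hW0 X, map_zero R⟩
  have hims : ∀ R X : E3 ≃ₗᵢ[ℝ] E3, -(R '' W X) = R '' W X := by
    intro R X
    ext y
    simp only [Set.mem_neg, mem_image]
    constructor
    · rintro ⟨x, hx, hxy⟩
      refine ⟨-x, by rw [← hWs X]; simpa using hx, ?_⟩
      rw [map_neg, hxy, neg_neg]
    · rintro ⟨x, hx, rfl⟩
      refine ⟨-x, by rw [← hWs X]; simpa using hx, ?_⟩
      rw [map_neg]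
  -- the wall kernels
  have hDc : ∀ v : E3, IsCompact (Dsc v) := fun v =>
    Metric.isCompact_of_isClosed_isBounded
      ((isClosed_le continuous_norm continuous_const).inter
        (isClosed_eq (continuous_id.inner continuous_const) continuous_const))
      (Metric.isBounded_closedBall.subset (cruxDisc_subset_closedBall v))
  have hDv : ∀ v : E3, Convex ℝ (Dsc v) := fun v => convex_cruxDisc v
  have hD0 : ∀ v : E3, (0 : E3) ∈ Dsc v := fun v => zero_mem_cruxDisc v
  have hD1 : ∀ v : E3, Dsc v ⊆ closedBall (0 : E3) 1 := fun v => cruxDisc_subset_closedBall v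
  -- the support gaps against the unit ball
  have hball : ∀ ν : E3, supportFn (closedBall (0 : E3) 1) ν = ‖ν‖ := fun ν => by
    unfold supportFn
    rw [sSup_inner_image_closedBall zero_le_one, one_mul]
  have hgap₂' : ∀ ν : E3, supportFn ((ℝ ∙ m₀)ᗮ.reflection '' W A) ν ≤
      supportFn (W B) ν + ε * supportFn (closedBall (0 : E3) 1) ν := fun ν => by
    rw [hball]; exact hgap₂ ν
  have hgap₁' : ∀ ν : E3, supportFn ((ℝ ∙ m₁)ᗮ.reflection '' W B) ν ≤
      supportFn (W A) ν + ε * supportFn (closedBall (0 : E3) 1) ν := fun ν => by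
    rw [hball]; exact hgap₁ ν
  -- the one-grain Wulff inequality for each grain
  have hWulff₁ : 6 * (2 : ℝ) ^ ((1 : ℝ) / 3) * (Real.sqrt 2 * (volume S₁).toReal) ^ ((2 : ℝ) / 3) ≤
      per (W A) S₁ := polycrystalWulffBound_singleGrain A (hasFinitePerimeter_of_poly hP₁ hv₁) hv₁
  have hWulff₂ : 6 * (2 : ℝ) ^ ((1 : ℝ) / 3) * (Real.sqrt 2 * (volume S₂).toReal) ^ ((2 : ℝ) / 3) ≤
      per (W B) S₂ := polycrystalWulffBound_singleGrain B (hasFinitePerimeter_of_poly hP₂ hv₂) hv₂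
  -- the body-level reduction (sharp), fed with the two twin inequalities of the named fact
  have key := twoGrain_nearTwin_sharp hP₁ hP₂ hv₁ hv₂ hd (hWc A) (hWv A) (hW0 A) (hWs A) (hWc B)
    (hWv B) (hW0 B) (hWs B) (himc ((ℝ ∙ m₁)ᗮ.reflection) B) (himv ((ℝ ∙ m₁)ᗮ.reflection) B)
    (him0 ((ℝ ∙ m₁)ᗮ.reflection) B) (hims ((ℝ ∙ m₁)ᗮ.reflection) B)
    (himc ((ℝ ∙ m₀)ᗮ.reflection) A) (himv ((ℝ ∙ m₀)ᗮ.reflection) A)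
    (him0 ((ℝ ∙ m₀)ᗮ.reflection) A) (hims ((ℝ ∙ m₀)ᗮ.reflection) A)
    (hDc m₀) (hDv m₀) (hD0 m₀) (hDc m₁) (hDv m₁) (hD0 m₁) (hWR A) (hWR B) (hWr A) (hWr B)
    (hD1 m₀) (hD1 m₁) hε hc hgap₂' hgap₁' hWulff₁ hWulff₂ (hTG A m₀ hA S₁ S₂ hP₁ hP₂ hv₁ hv₂ hd)
    (hTG B m₁ hB S₂ S₁ hP₂ hP₁ hv₂ hv₁ hd.symm)
  -- `Dsc 0` is the closed unit ball
  have hDB : Dsc 0 = closedBall (0 : E3) 1 := by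
    ext y
    show y ∈ {y : E3 | ‖y‖ ≤ 1 ∧ ⟪y, (0 : E3)⟫_ℝ = 0} ↔ y ∈ closedBall (0 : E3) 1
    rw [mem_setOf_eq, mem_closedBall_zero_iff, inner_zero_right]
    simp
  rw [← hDB] at key
  exact key

/-- **Near-twin reduction, operator-norm form, SHARP threshold** (`TwoGrainTwinInequality` by name):
`nearTwinFrames_of_twoGrainTwinInequality` verbatim with `2(2√5 − 1)·√5·δ ≤ √3(2 − 2^{2/3})`
(`δ ≤ 0.0460`: every frame `B` within `2.64°` of the twin frame `R_{m₀} ∘ A`).  Proof: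
`nearTwin_transport` + `nearTwinPair_of_twoGrainTwinInequality_sharp` with `ε = √5·δ`. -/
theorem nearTwinFrames_of_twoGrainTwinInequality_sharp (hTG : TwoGrainTwinInequality) {c δ : ℝ}
    (hc : 1 ≤ c)
    (hδ : 2 * (2 * Real.sqrt 5 - 1) * (Real.sqrt 5 * δ) ≤ Real.sqrt 3 * (2 - (2 : ℝ) ^ ((2 : ℝ) / 3))) :
    let Λ : Set (EuclideanSpace ℝ (Fin 3)) := Literature.MathematicalPhysics.StatisticalMechanics.fccStacking 1 (Real.sqrt (2 / 3));
    let Brl : (ℤ → ℤ) → Set (EuclideanSpace ℝ (Fin 3)) := Literature.MathematicalPhysics.StatisticalMechanics.barlowStacking 1 (Real.sqrt (2 / 3));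
    let Ax : EuclideanSpace ℝ (Fin 3) → (EuclideanSpace ℝ (Fin 3) ≃ₗᵢ[ℝ] EuclideanSpace ℝ (Fin 3)) → (EuclideanSpace ℝ (Fin 3) ≃ₗᵢ[ℝ] EuclideanSpace ℝ (Fin 3)) → Prop := fun m A B => ∃ (L : EuclideanSpace ℝ (Fin 3) ≃ₗᵢ[ℝ] EuclideanSpace ℝ (Fin 3)) (s₁ s₂ : EuclideanSpace ℝ (Fin 3)) (σ σ' : ℤ → ℤ), Literature.MathematicalPhysics.StatisticalMechanics.IsHaggSeq σ ∧ Literature.MathematicalPhysics.StatisticalMechanics.IsHaggSeq σ' ∧ L (EuclideanSpace.single (2 : Fin 3) (1 : ℝ)) = m ∧ A '' Λ ⊆ (fun q => L q + s₁) '' Brl σ ∧ B '' Λ ⊆ (fun q => L q + s₂) '' Brl σ';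
    let Φ : EuclideanSpace ℝ (Fin 3) → ℝ := fun ν => Real.sqrt 2 / 4 * ∑ᶠ w ∈ {w ∈ Λ | ‖w‖ = 1}, |⟪w, ν⟫_ℝ|;
    let Per : Set (EuclideanSpace ℝ (Fin 3)) → Set (EuclideanSpace ℝ (Fin 3)) → ℝ := fun K S => (⨆ (ξ : EuclideanSpace ℝ (Fin 3) → EuclideanSpace ℝ (Fin 3)) (_ : ContDiff ℝ 1 ξ ∧ HasCompactSupport ξ ∧ ∀ z, ξ z ∈ K), ENNReal.ofReal (∫ z in S, Literature.MathematicalPhysics.StatisticalMechanics.fieldDivergence ξ z)).toReal;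
    let ι : Set (EuclideanSpace ℝ (Fin 3)) → Set (EuclideanSpace ℝ (Fin 3)) → Set (EuclideanSpace ℝ (Fin 3)) → ℝ := fun K S₁ S₂ => (Per K S₁ + Per K S₂ - Per K (S₁ ∪ S₂)) / 2;
    let W : (EuclideanSpace ℝ (Fin 3) ≃ₗᵢ[ℝ] EuclideanSpace ℝ (Fin 3)) → Set (EuclideanSpace ℝ (Fin 3)) := fun A => {y | ∀ ν : EuclideanSpace ℝ (Fin 3), ⟪y, ν⟫_ℝ ≤ Φ (A.symm ν)};
    let Dsc : EuclideanSpace ℝ (Fin 3) → Set (EuclideanSpace ℝ (Fin 3)) := fun m => {y | ‖y‖ ≤ 1 ∧ ⟪y, m⟫_ℝ = 0};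
    let Poly : Set (EuclideanSpace ℝ (Fin 3)) → Prop := fun S => ∃ (k : ℕ) (H : Fin k → Finset ((EuclideanSpace ℝ (Fin 3)) × ℝ)), S = ⋃ i, ⋂ p ∈ H i, {x | ⟪p.1, x⟫_ℝ < p.2};
    ∀ (A B : EuclideanSpace ℝ (Fin 3) ≃ₗᵢ[ℝ] EuclideanSpace ℝ (Fin 3)) (m₀ : EuclideanSpace ℝ (Fin 3)), Ax m₀ A A →
      (∀ x : EuclideanSpace ℝ (Fin 3), ‖B x - (ℝ ∙ m₀)ᗮ.reflection (A x)‖ ≤ δ * ‖x‖) →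
      ∀ S₁ S₂ : Set (EuclideanSpace ℝ (Fin 3)), Poly S₁ → Poly S₂ → volume S₁ < ⊤ → volume S₂ < ⊤ → Disjoint S₁ S₂ →
        6 * (2 : ℝ) ^ ((1 : ℝ) / 3) * (Real.sqrt 2 * (volume (S₁ ∪ S₂)).toReal) ^ ((2 : ℝ) / 3) ≤
          (Per (W A) S₁ - ι (W A) S₁ S₂) + (Per (W B) S₂ - ι (W B) S₂ S₁) + c * ι (Dsc 0) S₁ S₂ := by
  intro Λ Brl Ax Φ Per ι W Dsc Poly A B m₀ hA hnear S₁ S₂ hP₁ hP₂ hv₁ hv₂ hd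
  obtain ⟨hB, hgap₂, hgap₁⟩ := nearTwin_transport hA hnear
  exact nearTwinPair_of_twoGrainTwinInequality_sharp hTG hc hδ A B m₀ (B (A.symm m₀)) hA hB hgap₂ hgap₁
    S₁ S₂ hP₁ hP₂ hv₁ hv₂ hd

end Summit.Ventures.Crystal3D.Cruxes.PolycrystalWulffBound.PolyDensity

end
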